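import Summits.BirchSwinnertonDyer.Rank1Residual.X11b.BDPRouteIntSeriesContinuity
import HarnessLib

/-!
# ♭-infrastructure (every `p`): CONTINUITY AT `T = 0` of the values of a `ℂ_p`-power series with a
# POSITIVE RADIUS — `‖G(x) − G(0)‖ ≤ (C/ρ)·‖x‖` on the closed disc `‖x‖ ≤ ρ` when `‖a_n‖ρⁿ ≤ C`, and the
# value at `𝟙` as the LIMIT of values along points `x_k → 0` (cell `bsd-eis`, seat `bsd-eis-cgshw` g14;
# route `EisensteinPrimes`, crux 4 `BSDpOnCellC` = stmt-BirchSwinnertonDyer-19034, COMMISSION (O2)-LZZ@3: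
# the kernel form of reading R-L1 «𝓛(χ_k) → 𝓛(𝟙)» for a `p`-adic `L`-function that is a rigid function
# on the open unit disc but NOT necessarily integral)

HONEST FRAMING (cell `bsd-eis`): THEOREMS ONLY (elementary ultrametric analysis; no definition, no named
fact, no `sorry`); nothing booked; X2 stays CONSTRUCTION-SHAPED; no label or count moves.

## Why

The X11b cell's `intSeries_tendsto_value_of_tendsto_zero` (`X11b/BDPRouteIntSeriesContinuity.lean`) gives
continuity at `T = 0` for INTEGRAL frames `Q ∈ 𝓞_{ℂ_p}⟦T⟧` (`‖Q(x) − Q(0)‖ ≤ ‖x‖`). The anticyclotomic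
`p`-adic `L`-function of Liu–Zhang–Zhang 2018 (Thm. 3.8: `𝓛(A) ∈ Lie A⁺ ⊗ Lie A⁻ ⊗ 𝒟(A, K)`) is an element
of a DISTRIBUTION algebra — by the Fourier theory of Schneider–Teitelbaum / Amice quoted there (LZZ §2.1,
arXiv:1511.08172 p. 7 «By [ST01] …») its restriction to a `ℤ_p`-line `Γ = γ^{ℤ_p}` is a rigid-analytic
function on the OPEN unit disc `{|T| < 1}`, `𝓛(χ) = G(χ(γ) − 1)`, i.e. a power series `G = Σ a_n Tⁿ ∈ ℂ_p⟦T⟧`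
with `‖a_n‖ρⁿ` bounded for every `ρ < 1` — not necessarily bounded by `1`. The typist of COMMISSION
(O2)-LZZ@3 (RULING L43 (2); cgshw MEMO-18 §4 (L3′)) can therefore state LZZ's continuity VERBATIM as
«`𝓛|_Γ` is such a power series», and the step «`𝓛(χ_k) → 𝓛(𝟙)` along interpolation characters with
`χ_k(γ) → 1`» (reading R-L1 of c2v MEMO-1) becomes THIS FILE's kernel theorem instead of a docstring reading:

* `norm_value_sub_coeff_zero_le_of_coeff_bound`: `‖a_n‖·ρⁿ ≤ C` (`ρ > 0`), `‖x‖ ≤ ρ`, `Σ a_n xⁿ = v`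
  ⟹ `‖v − a_0‖ ≤ (C/ρ)·‖x‖` (ultrametric: every tail term has norm `≤ C·(‖x‖/ρ)^{n+1} ≤ (C/ρ)·‖x‖`).
* `tendsto_value_of_tendsto_zero_of_coeff_bound`: values `v_k` at points `x_k → 0` tend to `a_0`.
* `coeff_zero_eq_of_tendsto_of_coeff_bound`: if moreover `v_k → w` then `w = a_0` — the value at the
  trivial character is DETERMINED by the values on any family of points accumulating at `0`.
* `PowerSeries` wrappers `powerSeries_tendsto_value_of_tendsto_zero` / `powerSeries_coeff_zero_eq_of_tendsto`
  (`a_n := PowerSeries.coeff n G`); `summable_of_coeff_bound` (values exist on the open disc `‖x‖ < ρ`).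

Nothing here is specific to `p = 3`, to LZZ18, or to crux 4. No label change; nothing booked.

References: [Washington1997] §7.1 (power series on the open unit disc); [SchneiderTeitelbaum2001]
(Fourier theory / distributions on `ℤ_p` as rigid functions on the open disc, as quoted in LZZ18 §2.1);
[LiuZhangZhang2018] Thm. 3.8 (arXiv:1511.08172 p. 18).
-/

noncomputable section

open scoped Classical Topology

open Filter PowerSeries
open Literature.NumberTheory.EllipticCurves

namespace Summit.BirchSwinnertonDyer.Rank1Residual.X2

variable {p : ℕ} [Fact p.Prime]

/-- **`‖G(x) − G(0)‖ ≤ (C/ρ)·‖x‖` on the closed disc of radius `ρ`** for a coefficient sequence with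
`‖a_n‖·ρⁿ ≤ C`: if `Σ a_n xⁿ = v` with `‖x‖ ≤ ρ`, then `v − a_0 = Σ_{n ≥ 1} a_n xⁿ` and every term has norm
`‖a_{n+1}‖‖x‖^{n+1} ≤ C·(‖x‖/ρ)^{n+1} ≤ (C/ρ)·‖x‖` (as `‖x‖/ρ ≤ 1`); the norm of `ℂ_p` is ultrametric.
[cite: Washington1997, §7.1] -/
theorem norm_value_sub_coeff_zero_le_of_coeff_bound {a : ℕ → ℂ_[p]} {C ρ : ℝ} (hρ : 0 < ρ)
    (hC : ∀ n, ‖a n‖ * ρ ^ n ≤ C) {x v : ℂ_[p]} (hx : ‖x‖ ≤ ρ)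
    (h : HasSum (fun n ↦ a n * x ^ n) v) : ‖v - a 0‖ ≤ C / ρ * ‖x‖ := by
  have hC0 : 0 ≤ C := by
    have h0 := hC 0
    rw [pow_zero, mul_one] at h0
    exact (norm_nonneg _).trans h0
  have h1 := (hasSum_nat_add_iff' 1).mpr h
  rw [Finset.sum_range_one, pow_zero, mul_one] at h1
  rw [← h1.tsum_eq]
  have hB : 0 ≤ C / ρ * ‖x‖ := mul_nonneg (div_nonneg hC0 hρ.le) (norm_nonneg x)
  refine IsUltrametricDist.norm_tsum_le_of_forall_le_of_nonneg hB fun k ↦ ?_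
  rw [norm_mul, norm_pow]
  -- `‖a (k+1)‖ ≤ C / ρ^(k+1)`
  have hρk : 0 < ρ ^ (k + 1) := pow_pos hρ _
  have hak : ‖a (k + 1)‖ ≤ C / ρ ^ (k + 1) := by
    rw [le_div_iff₀ hρk]
    exact hC (k + 1)
  -- `‖x‖^(k+1) ≤ ρ^k · ‖x‖`
  have hxk : ‖x‖ ^ (k + 1) ≤ ρ ^ k * ‖x‖ := by
    rw [pow_succ]
    exact mul_le_mul_of_nonneg_right (pow_le_pow_left₀ (norm_nonneg x) hx k) (norm_nonneg x)
  calc ‖a (k + 1)‖ * ‖x‖ ^ (k + 1)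
      ≤ (C / ρ ^ (k + 1)) * (ρ ^ k * ‖x‖) :=
        mul_le_mul hak hxk (pow_nonneg (norm_nonneg x) _) (div_nonneg hC0 hρk.le)
    _ = C / ρ * ‖x‖ := by
        rw [pow_succ]
        field_simp

/-- **Continuity of the values at `T = 0`** for a coefficient sequence with `‖a_n‖·ρⁿ ≤ C`, `ρ > 0` (any
power series with a positive radius of convergence): if `Σ_n a_n (x_k)ⁿ = v_k` at points `x_k → 0`, then
`v_k → a_0`. [cite: Washington1997, §7.1] -/
theorem tendsto_value_of_tendsto_zero_of_coeff_bound {a : ℕ → ℂ_[p]} {C ρ : ℝ} (hρ : 0 < ρ)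
    (hC : ∀ n, ‖a n‖ * ρ ^ n ≤ C) {x v : ℕ → ℂ_[p]} (hx : Tendsto x atTop (𝓝 0))
    (h : ∀ k, HasSum (fun n ↦ a n * x k ^ n) (v k)) : Tendsto v atTop (𝓝 (a 0)) := by
  rw [tendsto_iff_norm_sub_tendsto_zero]
  have hx' : Tendsto (fun k ↦ ‖x k‖) atTop (𝓝 0) := by
    simpa using (tendsto_iff_norm_sub_tendsto_zero.mp hx)
  have hev : ∀ᶠ k in atTop, ‖v k - a 0‖ ≤ C / ρ * ‖x k‖ := by
    have h1 : ∀ᶠ k in atTop, ‖x k‖ ≤ ρ := hx'.eventually (eventually_le_nhds hρ)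
    filter_upwards [h1] with k hk
    exact norm_value_sub_coeff_zero_le_of_coeff_bound hρ hC hk (h k)
  have hlim : Tendsto (fun k ↦ C / ρ * ‖x k‖) atTop (𝓝 0) := by
    simpa using hx'.const_mul (C / ρ)
  exact squeeze_zero' (Eventually.of_forall fun k ↦ norm_nonneg _) hev hlim

/-- **The value at `𝟙` as a LIMIT**: under the same bound, if the values `v_k` at points `x_k → 0` tend to
`w`, then `w = a_0` — the value at `T = 0` is determined by the values on any family of points
accumulating at `0` (e.g. the interpolation points `χ_k(γ) − 1` of characters `χ_k → 𝟙`).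
[cite: Washington1997, §7.1] -/
theorem coeff_zero_eq_of_tendsto_of_coeff_bound {a : ℕ → ℂ_[p]} {C ρ : ℝ} (hρ : 0 < ρ)
    (hC : ∀ n, ‖a n‖ * ρ ^ n ≤ C) {x v : ℕ → ℂ_[p]} {w : ℂ_[p]} (hx : Tendsto x atTop (𝓝 0))
    (hv : Tendsto v atTop (𝓝 w)) (h : ∀ k, HasSum (fun n ↦ a n * x k ^ n) (v k)) : w = a 0 :=
  tendsto_nhds_unique hv (tendsto_value_of_tendsto_zero_of_coeff_bound hρ hC hx h)

/-- `PowerSeries` form of `tendsto_value_of_tendsto_zero_of_coeff_bound`: for `G ∈ ℂ_p⟦T⟧` with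
`‖[Tⁿ]G‖·ρⁿ ≤ C` (`ρ > 0`), values at points `x_k → 0` tend to the constant term `[T⁰]G`.
[cite: Washington1997, §7.1] -/
theorem powerSeries_tendsto_value_of_tendsto_zero {G : PowerSeries ℂ_[p]} {C ρ : ℝ} (hρ : 0 < ρ)
    (hC : ∀ n, ‖PowerSeries.coeff n G‖ * ρ ^ n ≤ C) {x v : ℕ → ℂ_[p]}
    (hx : Tendsto x atTop (𝓝 0)) (h : ∀ k, HasSum (fun n ↦ PowerSeries.coeff n G * x k ^ n) (v k)) :
    Tendsto v atTop (𝓝 (PowerSeries.constantCoeff G)) := by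
  rw [← PowerSeries.coeff_zero_eq_constantCoeff_apply]
  exact tendsto_value_of_tendsto_zero_of_coeff_bound (a := fun n ↦ PowerSeries.coeff n G) hρ hC hx h

/-- `PowerSeries` form of `coeff_zero_eq_of_tendsto_of_coeff_bound`: the limit of the values IS the
constant term. [cite: Washington1997, §7.1] -/
theorem powerSeries_coeff_zero_eq_of_tendsto {G : PowerSeries ℂ_[p]} {C ρ : ℝ} (hρ : 0 < ρ)
    (hC : ∀ n, ‖PowerSeries.coeff n G‖ * ρ ^ n ≤ C) {x v : ℕ → ℂ_[p]} {w : ℂ_[p]}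
    (hx : Tendsto x atTop (𝓝 0)) (hv : Tendsto v atTop (𝓝 w))
    (h : ∀ k, HasSum (fun n ↦ PowerSeries.coeff n G * x k ^ n) (v k)) :
    w = PowerSeries.constantCoeff G :=
  tendsto_nhds_unique hv (powerSeries_tendsto_value_of_tendsto_zero hρ hC hx h)

/-- **Values exist on the open disc of radius `ρ`**: if `‖a_n‖·ρⁿ ≤ C` and `‖x‖ < ρ`, the series
`Σ a_n xⁿ` is summable in `ℂ_p` (domination by the geometric series `C·(‖x‖/ρ)ⁿ`; `ℂ_p` is complete).
[cite: Washington1997, §7.1] -/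
theorem summable_of_coeff_bound {a : ℕ → ℂ_[p]} {C ρ : ℝ} (hρ : 0 < ρ)
    (hC : ∀ n, ‖a n‖ * ρ ^ n ≤ C) {x : ℂ_[p]} (hx : ‖x‖ < ρ) :
    Summable (fun n ↦ a n * x ^ n) := by
  have hC0 : 0 ≤ C := by
    have h0 := hC 0
    rw [pow_zero, mul_one] at h0
    exact (norm_nonneg _).trans h0
  have hr0 : 0 ≤ ‖x‖ / ρ := div_nonneg (norm_nonneg x) hρ.le
  have hr1 : ‖x‖ / ρ < 1 := (div_lt_one hρ).mpr hx
  refine Summable.of_norm_bounded ((summable_geometric_of_lt_one hr0 hr1).mul_left C) fun n ↦ ?_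
  rw [norm_mul, norm_pow, div_pow]
  have hρn : 0 < ρ ^ n := pow_pos hρ n
  have han : ‖a n‖ ≤ C / ρ ^ n := by
    rw [le_div_iff₀ hρn]
    exact hC n
  calc ‖a n‖ * ‖x‖ ^ n ≤ (C / ρ ^ n) * ‖x‖ ^ n :=
        mul_le_mul_of_nonneg_right han (pow_nonneg (norm_nonneg x) n)
    _ = C * (‖x‖ ^ n / ρ ^ n) := by ring

end Summit.BirchSwinnertonDyer.Rank1Residual.X2

end
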